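import Summits.CriticalPhenomena.PercolationContinuityZ3.Theorems.PercNearOneGluingNoHeavyQuantLightPairCatHullColumns
import Summits.CriticalPhenomena.PercolationContinuityZ3.Theorems.PercNearOneGluingNoHeavyQuantCatHullLightSplit
import HarnessLib

/-!
# QUANT lane R8, T-DEC: THE SMALL-GATE PAIR LEMMA — products of two gated hull members whose outer gates are small
# (`s·m_P + t·m_Q ≤ min(m_P, m_Q)`) are hull members by RE-GATING (three columns, closed form, every floor the re-gating affords);
# the pair lemma (P) `CatPairLight` on that region; the light glued pair `(R¹[q](R^c[s]))²` for EVERY `q ≤ 1/2`, `s`, `c` (two columns)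

builds on p205010 (kernel theorem, internal audit signed; external expert review pending)

Support file (`--supports stmt-CriticalPhenomena-4575`), QUANT lane census seat prim-quant-census-2 (gen 77), rung R8 of
`run/shared/lean/prim/quant/LADDER.md`.  Theorems only (no definition, no conjecture); standard axioms, no sorries.

WHAT.  The light node `TreeBuiltCatHullLight` (✓ p419856) reduces to the pair lemma (P) `CatPairLight` (✓ p424685, `…QuantCatHullLightSplit`):
the independent join `gate_s P ∗ gate_t Q` of two gated caterpillar columns at a light floor should be a finite mixture of gated caterpillars of
the summed mean `T = s·m_P + t·m_Q`.  Expanding, `gate_s P ∗ gate_t Q = st·(P∗Q) + s(1−t)·P + (1−s)t·Q + (1−s)(1−t)·δ₀`; the three laws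
`P`, `Q`, `P ∗ Q` have means `m_P`, `m_Q`, `m_P + m_Q`, and an outer gate `u ≤ 1` lowers a mean by the factor `u` at the price of `δ₀`-mass.
**If both `m_P ≥ T` and `m_Q ≥ T` ("small gates"; it forces `s + t ≤ 1`, so the floor is automatically light), re-gating each of the three
laws to mean exactly `T` balances the `δ₀`-mass EXACTLY:**
  `gate_s P ∗ gate_t Q = α·gate_{T/m_P} P + β·gate_{T/m_Q} Q + γ·gate_{T/(m_P+m_Q)} (P ∗ Q)`,
  `α = s(1−t)m_P/T`, `β = (1−s)t·m_Q/T`, `γ = st(m_P+m_Q)/T`, `α + β + γ = 1`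
(`lconv_gate_gate_eq_regate`, pure algebra).  Since the hull is gate-stable (`inGatedCatHull_gate`, typer g41) this gives:
* **`InGatedCatHull.lconv_gate_gate_of_small`** (hull-relative form): `P ∈ FH(y₁, m_P)`, `Q ∈ FH(y₂, m_Q)`, `P ∗ Q ∈ FH(y₃, m_P + m_Q)`, small gates
  ⟹ `gate_s P ∗ gate_t Q ∈ FH(y, T)` at every floor `y` with `y·m_P ≤ y₁·T`, `y·m_Q ≤ y₂·T`, `y·(m_P+m_Q) ≤ y₃·T`;
* `catBuilt_lconv_blobLaw` (a caterpillar joined with independent heavy blobs is a caterpillar — successive slices);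
* **`catPair_inGatedCatHull_of_small`** — (P)'s conclusion for caterpillar columns `gate P s`, `gate Q t` (`CatBuilt (y/s) N₁ P`, `CatBuilt (y/t) N₂ Q`)
  whenever `P ∗ Q` is a caterpillar at a floor `x₃` with `y(m_P+m_Q) ≤ x₃·T` and the gates are small; **`catPairBlob_inGatedCatHull_of_small`** — the
  case `Q` a blob forest (`P ∗ Q` is then a caterpillar for free): `s ≤ t`, blob gates `≥ y/s`, small gates ⟹ member at floor `y`, NO other hypothesis;
* **`lpT_inGatedCatHull_lowGate : 0 < q ≤ 1/2 → 0 < s < 1 → InGatedCatHull (q·s) (2q(1+cs)) (2c+2) (lpT c q s)`** — the light glued pair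
  `T = (R¹[q](R^c[s]))²` of census-2 g76 (`…QuantLightPairCatHullColumns`) at its NATURAL floor for EVERY `c`, EVERY `s` and EVERY root gate `q ≤ 1/2`,
  as the TWO-column member `(1−q)·gate_{2q}(ρ) + q·gate_q(ρ ∗ ρ)`, `ρ = δ₁ ∗ blob(c, s)`; with `_below` (every floor `≤ qs`), `sdec_lpT_lowGate`,
  `lpT_gate_inGatedCatHull_lowGate` (every outer gate) and **`treeBuiltCatHull_lpT_lowGate`** (the light node on every tree-built presentation at a
  floor `≤ qs`).  Census-2 g76's closed forms (`lpT_inGatedCatHull_Lt/_C`, `lpT_half_inGatedCatHull`) all need `q > 1/2` (FREEHULL-G75 §4c's peel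
  `π ≥ 0 iff q ≥ 1/2`) and its dictionary reported "`q ≤ .6` not covered"; the strip `q ≤ 1/2` is the complementary EASY regime.
WHY IT MATTERS.  A hypothesis-light STRUCTURAL piece of (P) (arbitrary caterpillars / hull members, not a parametric family): in the regime where
every factor's mean dominates the target, the gate zero pays for all re-gatings and no blob gate has to be re-tuned (contrast FREEHULL-G75 §4c:
for `q > 1/2` the residual caterpillar `ρ ∗ gate_{2q−1}(ρ)` violates the floor and every certificate RE-TUNES gates — census-2 g76's five columns).
The identity is the `k = 2` case of `gate_q(ρ)^{∗k} = Σⱼ Bin(k−1,q)(j−1)·gate_{kq/j}(ρ^{∗j})` (`q ≤ 1/k`), not typed here.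
HONEST STATUS.  Instances/region of (P) only (small outer gates); the hard light corner `q → 1`, `s → 1/(2q)` is untouched; `TreeBuiltCatHullLight`,
`CatPairLight`, `SiblingStep`, `FarTreeRow` remain OPEN; RATE class log\* / honest sentence of `run/shared/lean/prim/quant/README.md` unchanged.
[this work]; hull API: prim-quant-stmt g41, prim-quant-lead g47; the family `lpT`: prim-quant-census-2 g76.  Nothing here is cited as a published
result.  The gluing rows served [cite: KozmaNitzan2024, Conjecture 3 (p. 15)]; product measure [cite: Grimmett1999, §1.3 p. 10].
-/

noncomputable section

open scoped BigOperators

namespace Summit.CriticalPhenomena.PercolationContinuityZ3.Theorems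
namespace Quant
namespace LawDec

open Finset

/-! ### The re-gating identity (pure algebra) -/

/-- the product of two gated laws, expanded: `gate_s P ∗ gate_t Q = st·(P∗Q) + s(1−t)·P + (1−s)t·Q + (1−s)(1−t)·δ₀`. [this work] -/
theorem lconv_gate_gate_expand (N₁ N₂ : ℕ) (P Q : ℕ → ℝ) (s t : ℝ) (hPM : ∀ h, N₁ < h → P h = 0) (hQM : ∀ h, N₂ < h → Q h = 0)
    (h : ℕ) :
    lconv N₁ N₂ (gate P s) (gate Q t) h =
      s * t * lconv N₁ N₂ P Q h + s * (1 - t) * P h + (1 - s) * t * Q h + (1 - s) * (1 - t) * (if h = 0 then (1 : ℝ) else 0) := by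
  have hQM' : ∀ k, N₂ < k → gate Q t k = 0 := fun k hk => by
    rw [gate_apply, hQM k hk, if_neg (by omega)]; ring
  rw [lconv_gate_left N₁ N₂ P (gate Q t) s hQM' h, lconv_gate_right N₁ N₂ P Q t hPM h, gate_apply]
  ring

/-- **THE RE-GATING IDENTITY.**  With `T = s·m₁ + t·m₂` (all of `m₁, m₂, m₁ + m₂, T` nonzero):
`gate_s P ∗ gate_t Q = (s(1−t)m₁/T)·gate_{T/m₁} P + ((1−s)t·m₂/T)·gate_{T/m₂} Q + (st(m₁+m₂)/T)·gate_{T/(m₁+m₂)} (P ∗ Q)` pointwise —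
each law re-gated to mean `T` when `m₁`, `m₂` are the means of `P`, `Q`; the `δ₀`-masses balance exactly. [this work] -/
theorem lconv_gate_gate_eq_regate (N₁ N₂ : ℕ) (P Q : ℕ → ℝ) (s t m₁ m₂ : ℝ) (hPM : ∀ h, N₁ < h → P h = 0)
    (hQM : ∀ h, N₂ < h → Q h = 0) (hm₁ : m₁ ≠ 0) (hm₂ : m₂ ≠ 0) (hm : m₁ + m₂ ≠ 0) (hT : s * m₁ + t * m₂ ≠ 0) (h : ℕ) :
    lconv N₁ N₂ (gate P s) (gate Q t) h =
      (s * (1 - t) * m₁ / (s * m₁ + t * m₂)) * gate P ((s * m₁ + t * m₂) / m₁) h +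
        ((1 - s) * t * m₂ / (s * m₁ + t * m₂)) * gate Q ((s * m₁ + t * m₂) / m₂) h +
        (s * t * (m₁ + m₂) / (s * m₁ + t * m₂)) * gate (lconv N₁ N₂ P Q) ((s * m₁ + t * m₂) / (m₁ + m₂)) h := by
  rw [lconv_gate_gate_expand N₁ N₂ P Q s t hPM hQM h, gate_apply, gate_apply, gate_apply]
  field_simp
  ring

/-! ### Three-column mixtures -/

/-- a three-term mixture of members (common floor, mean, top) is a member. [this work] -/
theorem InGatedCatHull.mix3 {y T : ℝ} {M : ℕ} {A B C μ : ℕ → ℝ} (a b c : ℝ) (ha : 0 ≤ a) (hb : 0 ≤ b) (hc : 0 ≤ c)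
    (habc : a + b + c = 1) (hA : InGatedCatHull y T M A) (hB : InGatedCatHull y T M B) (hC : InGatedCatHull y T M C)
    (hμ : ∀ h, μ h = a * A h + b * B h + c * C h) : InGatedCatHull y T M μ := by
  refine InGatedCatHull.mixture ![a, b, c] ![A, B, C] ?_ ?_ ?_ μ ?_
  · intro k
    fin_cases k <;> simpa
  · rw [Fin.sum_univ_three]
    simpa using habc
  · intro k
    fin_cases k
    · simpa using hA
    · simpa using hB
    · simpa using hC
  · intro h
    rw [Fin.sum_univ_three, hμ h]
    simp

/-! ### The small-gate pair lemma, hull-relative form -/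

/-- **THE SMALL-GATE PAIR LEMMA (hull-relative).**  Let `P ∈ FH(y₁, m₁, N₁)`, `Q ∈ FH(y₂, m₂, N₂)` and `P ∗ Q ∈ FH(y₃, m₁ + m₂, N₁ + N₂)` be members
(`0 < m₁, m₂`), and let `0 ≤ s, t ≤ 1` be outer gates that are SMALL: `T := s·m₁ + t·m₂ ≤ min(m₁, m₂)` (`0 < T`).  Then the independent join
`gate_s P ∗ gate_t Q` is a member of `FH(y, T, N₁ + N₂)` at every floor `0 < y` the three re-gatings afford: `y·m₁ ≤ y₁·T`, `y·m₂ ≤ y₂·T`,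
`y·(m₁ + m₂) ≤ y₃·T`.  Proof: `lconv_gate_gate_eq_regate`, `inGatedCatHull_gate`, `InGatedCatHull.mono`/`mono_top`, `mix3`. [this work] -/
theorem InGatedCatHull.lconv_gate_gate_of_small {y y₁ y₂ y₃ m₁ m₂ s t : ℝ} {N₁ N₂ : ℕ} {P Q : ℕ → ℝ}
    (hP : InGatedCatHull y₁ m₁ N₁ P) (hQ : InGatedCatHull y₂ m₂ N₂ Q)
    (hPQ : InGatedCatHull y₃ (m₁ + m₂) (N₁ + N₂) (lconv N₁ N₂ P Q))
    (hy0 : 0 < y) (hy₁ : 0 ≤ y₁) (hy₂ : 0 ≤ y₂) (hy₃ : 0 ≤ y₃) (hm₁ : 0 < m₁) (hm₂ : 0 < m₂)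
    (hs0 : 0 ≤ s) (hs1 : s ≤ 1) (ht0 : 0 ≤ t) (ht1 : t ≤ 1) (hT0 : 0 < s * m₁ + t * m₂)
    (hT₁ : s * m₁ + t * m₂ ≤ m₁) (hT₂ : s * m₁ + t * m₂ ≤ m₂)
    (hf₁ : y * m₁ ≤ y₁ * (s * m₁ + t * m₂)) (hf₂ : y * m₂ ≤ y₂ * (s * m₁ + t * m₂))
    (hf₃ : y * (m₁ + m₂) ≤ y₃ * (s * m₁ + t * m₂)) :
    InGatedCatHull y (s * m₁ + t * m₂) (N₁ + N₂) (lconv N₁ N₂ (gate P s) (gate Q t)) := by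
  set T := s * m₁ + t * m₂ with hTdef
  have hm : 0 < m₁ + m₂ := by linarith
  have hT₃ : T ≤ m₁ + m₂ := by linarith
  -- the three re-gated columns, at floor `y`, mean `T`, top `N₁ + N₂`
  have hA : InGatedCatHull y T (N₁ + N₂) (gate P (T / m₁)) := by
    have g := inGatedCatHull_gate hP hy₁ (T / m₁) (div_pos hT0 hm₁) ((div_le_one hm₁).2 hT₁)
    rw [div_mul_cancel₀ T hm₁.ne'] at g
    have hfl : y ≤ T / m₁ * y₁ := by
      rw [div_mul_eq_mul_div, le_div_iff₀ hm₁]; nlinarith [hf₁]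
    exact (g.mono hy0 hfl).mono_top (Nat.le_add_right N₁ N₂)
  have hB : InGatedCatHull y T (N₁ + N₂) (gate Q (T / m₂)) := by
    have g := inGatedCatHull_gate hQ hy₂ (T / m₂) (div_pos hT0 hm₂) ((div_le_one hm₂).2 hT₂)
    rw [div_mul_cancel₀ T hm₂.ne'] at g
    have hfl : y ≤ T / m₂ * y₂ := by
      rw [div_mul_eq_mul_div, le_div_iff₀ hm₂]; nlinarith [hf₂]
    exact (g.mono hy0 hfl).mono_top (Nat.le_add_left N₂ N₁)
  have hC : InGatedCatHull y T (N₁ + N₂) (gate (lconv N₁ N₂ P Q) (T / (m₁ + m₂))) := by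
    have g := inGatedCatHull_gate hPQ hy₃ (T / (m₁ + m₂)) (div_pos hT0 hm) ((div_le_one hm).2 hT₃)
    rw [div_mul_cancel₀ T hm.ne'] at g
    have hfl : y ≤ T / (m₁ + m₂) * y₃ := by
      rw [div_mul_eq_mul_div, le_div_iff₀ hm]; nlinarith [hf₃]
    exact g.mono hy0 hfl
  -- law bookkeeping for the identity
  have hPM : ∀ h, N₁ < h → P h = 0 := (hP.lawFacts hy₁).2.1
  have hQM : ∀ h, N₂ < h → Q h = 0 := (hQ.lawFacts hy₂).2.1
  refine InGatedCatHull.mix3 (s * (1 - t) * m₁ / T) ((1 - s) * t * m₂ / T) (s * t * (m₁ + m₂) / T)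
    (div_nonneg (mul_nonneg (mul_nonneg hs0 (by linarith)) hm₁.le) hT0.le)
    (div_nonneg (mul_nonneg (mul_nonneg (by linarith) ht0) hm₂.le) hT0.le)
    (div_nonneg (mul_nonneg (mul_nonneg hs0 ht0) hm.le) hT0.le) ?_ hA hB hC fun h => ?_
  · field_simp
    ring
  · exact lconv_gate_gate_eq_regate N₁ N₂ P Q s t m₁ m₂ hPM hQM hm₁.ne' hm₂.ne' hm.ne' hT0.ne' h

/-! ### Caterpillars joined with blob forests -/

/-- **a caterpillar joined with independent heavy blobs is a caterpillar** (at the same floor): `CatBuilt x M μ`, gates of `l` in `[x, 1]` ⟹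
`CatBuilt x (M + blobTop l) (μ ∗ blobLaw l)` — successive slices (`lconv_gate_point_eq_slice`, `lconv_assoc`). [this work] -/
theorem catBuilt_lconv_blobLaw {x : ℝ} {M : ℕ} {μ : ℕ → ℝ} (hμ : CatBuilt x M μ) :
    ∀ l : List (ℕ × ℝ), (∀ p ∈ l, x ≤ p.2 ∧ p.2 ≤ 1) → CatBuilt x (M + blobTop l) (lconv M (blobTop l) μ (blobLaw l))
  | [], _ => by
    have e : lconv M (blobTop []) μ (blobLaw []) = μ := by
      simp only [blobTop, blobLaw]
      exact funext fun h => lconv_delta_right M 0 μ hμ.lawFacts.2.1 h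
    rw [e]
    simpa only [blobTop, Nat.add_zero] using hμ
  | p :: l, hl => by
    have hl' : ∀ p' ∈ l, x ≤ p'.2 ∧ p'.2 ≤ 1 := fun p' hp' => hl p' (List.mem_cons_of_mem p hp')
    obtain ⟨hxp, hp1⟩ := hl p List.mem_cons_self
    have ih := catBuilt_lconv_blobLaw hμ l hl'
    have nM : ∀ h, M + blobTop l < h → lconv M (blobTop l) μ (blobLaw l) h = 0 := fun h hh => lconv_eq_zero _ _ _ _ h hh
    have e : lconv M (blobTop (p :: l)) μ (blobLaw (p :: l)) = slice (lconv M (blobTop l) μ (blobLaw l)) p.1 p.2 := by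
      simp only [blobTop, blobLaw]
      rw [← lconv_gate_point_eq_slice (blobTop l) p.1 (blobLaw l) p.2 (fun k hk => blobLaw_eq_zero l k hk), lconv_assoc,
        lconv_gate_point_eq_slice (M + blobTop l) p.1 _ p.2 nM]
    rw [e, show M + blobTop (p :: l) = M + blobTop l + p.1 by simp only [blobTop]; omega]
    exact ih.slice p.1 p.2 hxp hp1

/-! ### The small-gate pair lemma for caterpillar columns (instances of (P) `CatPairLight`) -/

/-- **(P) FOR SMALL GATES, GIVEN THAT `P ∗ Q` IS A CATERPILLAR.**  Caterpillar columns `gate P s`, `gate Q t` at floor `y` (`y < s, t ≤ 1`,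
`CatBuilt (y/s) N₁ P`, `CatBuilt (y/t) N₂ Q`, means `m_P, m_Q > 0`) with SMALL gates (`s·m_P + t·m_Q ≤ min(m_P, m_Q)`) and `P ∗ Q` a caterpillar at
a floor `x₃` with `y·(m_P + m_Q) ≤ x₃·(s·m_P + t·m_Q)`: the join is a member of `FH(y, s·m_P + t·m_Q, N₁ + N₂)` — (P)'s conclusion. [this work] -/
theorem catPair_inGatedCatHull_of_small {y s t x₃ : ℝ} {N₁ N₂ : ℕ} {P Q : ℕ → ℝ}
    (hy0 : 0 < y) (hys : y < s) (hs1 : s ≤ 1) (hyt : y < t) (ht1 : t ≤ 1)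
    (hP : CatBuilt (y / s) N₁ P) (hQ : CatBuilt (y / t) N₂ Q) (hx₃ : 0 ≤ x₃) (hPQ : CatBuilt x₃ (N₁ + N₂) (lconv N₁ N₂ P Q))
    (hmP : 0 < ∑ h ∈ Finset.range (N₁ + 1), (h : ℝ) * P h) (hmQ : 0 < ∑ h ∈ Finset.range (N₂ + 1), (h : ℝ) * Q h)
    (hT₁ : s * (∑ h ∈ Finset.range (N₁ + 1), (h : ℝ) * P h) + t * (∑ h ∈ Finset.range (N₂ + 1), (h : ℝ) * Q h)
      ≤ ∑ h ∈ Finset.range (N₁ + 1), (h : ℝ) * P h)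
    (hT₂ : s * (∑ h ∈ Finset.range (N₁ + 1), (h : ℝ) * P h) + t * (∑ h ∈ Finset.range (N₂ + 1), (h : ℝ) * Q h)
      ≤ ∑ h ∈ Finset.range (N₂ + 1), (h : ℝ) * Q h)
    (hf : y * ((∑ h ∈ Finset.range (N₁ + 1), (h : ℝ) * P h) + ∑ h ∈ Finset.range (N₂ + 1), (h : ℝ) * Q h)
      ≤ x₃ * (s * (∑ h ∈ Finset.range (N₁ + 1), (h : ℝ) * P h) + t * (∑ h ∈ Finset.range (N₂ + 1), (h : ℝ) * Q h))) :
    InGatedCatHull y (s * (∑ h ∈ Finset.range (N₁ + 1), (h : ℝ) * P h) + t * (∑ h ∈ Finset.range (N₂ + 1), (h : ℝ) * Q h))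
      (N₁ + N₂) (lconv N₁ N₂ (gate P s) (gate Q t)) := by
  set mP := ∑ h ∈ Finset.range (N₁ + 1), (h : ℝ) * P h with hmPdef
  set mQ := ∑ h ∈ Finset.range (N₂ + 1), (h : ℝ) * Q h with hmQdef
  have hs0 : 0 < s := hy0.trans hys
  have ht0 : 0 < t := hy0.trans hyt
  have hP' : InGatedCatHull (y / s) mP N₁ P := inGatedCatHull_of_catBuilt hP
  have hQ' : InGatedCatHull (y / t) mQ N₂ Q := inGatedCatHull_of_catBuilt hQ
  have hPQ' : InGatedCatHull x₃ (mP + mQ) (N₁ + N₂) (lconv N₁ N₂ P Q) := by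
    have g := inGatedCatHull_of_catBuilt hPQ
    obtain ⟨_, _, p1, _⟩ := hP.lawFacts
    obtain ⟨_, _, q1, _⟩ := hQ.lawFacts
    rwa [sum_mul_lconv N₁ N₂ P Q p1 q1] at g
  have hT0 : 0 < s * mP + t * mQ := by positivity
  refine InGatedCatHull.lconv_gate_gate_of_small hP' hQ' hPQ' hy0 (div_pos hy0 hs0).le (div_pos hy0 ht0).le hx₃ hmP hmQ
    hs0.le hs1 ht0.le ht1 hT0 hT₁ hT₂ ?_ ?_ hf
  · rw [div_mul_eq_mul_div, le_div_iff₀ hs0]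
    nlinarith [mul_nonneg ht0.le hmQ.le, hy0]
  · rw [div_mul_eq_mul_div, le_div_iff₀ ht0]
    nlinarith [mul_nonneg hs0.le hmP.le, hy0]

/-- **(P) FOR SMALL GATES, `Q` A BLOB FOREST — no further hypothesis.**  A caterpillar column `gate P s` (`CatBuilt (y/s) N₁ P`, mean `m_P > 0`)
and a gated blob forest `gate (blobLaw l) t` with `y < s ≤ t ≤ 1` and blob gates in `[y/s, 1]` (so `P ∗ blobLaw l` is a caterpillar at floor `y/s`,
`catBuilt_lconv_blobLaw`), with SMALL gates `s·m_P + t·blobMean l ≤ min(m_P, blobMean l)`: the join is in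
`FH(y, s·m_P + t·blobMean l, N₁ + blobTop l)`. [this work] -/
theorem catPairBlob_inGatedCatHull_of_small {y s t : ℝ} {N₁ : ℕ} {P : ℕ → ℝ} (l : List (ℕ × ℝ))
    (hy0 : 0 < y) (hys : y < s) (hst : s ≤ t) (ht1 : t ≤ 1) (hP : CatBuilt (y / s) N₁ P)
    (hl : ∀ p ∈ l, y / s ≤ p.2 ∧ p.2 ≤ 1) (hmP : 0 < ∑ h ∈ Finset.range (N₁ + 1), (h : ℝ) * P h) (hmQ : 0 < blobMean l)
    (hT₁ : s * (∑ h ∈ Finset.range (N₁ + 1), (h : ℝ) * P h) + t * blobMean l ≤ ∑ h ∈ Finset.range (N₁ + 1), (h : ℝ) * P h)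
    (hT₂ : s * (∑ h ∈ Finset.range (N₁ + 1), (h : ℝ) * P h) + t * blobMean l ≤ blobMean l) :
    InGatedCatHull y (s * (∑ h ∈ Finset.range (N₁ + 1), (h : ℝ) * P h) + t * blobMean l) (N₁ + blobTop l)
      (lconv N₁ (blobTop l) (gate P s) (gate (blobLaw l) t)) := by
  have hs0 : 0 < s := hy0.trans hys
  have ht0 : 0 < t := hs0.trans_le hst
  have hs1 : s ≤ 1 := hst.trans ht1
  have hys' : y / s < 1 := (div_lt_one hs0).2 hys
  have hyt' : y / t ≤ y / s := div_le_div_of_nonneg_left hy0.le hs0 hst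
  have hQ : CatBuilt (y / t) (blobTop l) (blobLaw l) :=
    catBuilt_blobLaw (y / t) (div_pos hy0 ht0) ((div_lt_one ht0).2 (hys.trans_le hst)) l
      fun p hp => ⟨hyt'.trans (hl p hp).1, (hl p hp).2⟩
  have hPQ : CatBuilt (y / s) (N₁ + blobTop l) (lconv N₁ (blobTop l) P (blobLaw l)) := catBuilt_lconv_blobLaw hP l hl
  have key := catPair_inGatedCatHull_of_small hy0 hys hs1 (hys.trans_le hst) ht1 hP hQ (div_pos hy0 hs0).le hPQ hmP
    (by rw [sum_mul_blobLaw]; exact hmQ) (by rw [sum_mul_blobLaw]; exact hT₁) (by rw [sum_mul_blobLaw]; exact hT₂)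
    (by
      rw [sum_mul_blobLaw, div_mul_eq_mul_div, le_div_iff₀ hs0]
      nlinarith [mul_nonneg hmQ.le (sub_nonneg.2 hst), hy0])
  rwa [sum_mul_blobLaw] at key

/-! ### The light glued pair `(R¹[q](R^c[s]))²` for every root gate `q ≤ 1/2` -/

/-- the sibling's inner law `ρ = δ₁ ∗ blob(c, s)` is the blob forest `blobLaw [(c, s), (1, 1)]`. [this work] -/
theorem lpRho_eq_blobLaw (c : ℕ) (s : ℝ) : slice (pointLaw 1) c s = blobLaw [(c, s), (1, 1)] := by
  simp only [blobLaw]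
  show slice (pointLaw 1) c s = slice (slice (pointLaw 0) 1 1) c s
  rw [slice_pointLaw_zero_one]

/-- top of that blob list. [this work] -/
theorem lpRho_blobTop (c : ℕ) (s : ℝ) : blobTop [(c, s), (1, 1)] = c + 1 := by
  simp only [blobTop]; omega

/-- mean of that blob list: `1 + c·s`. [this work] -/
theorem lpRho_blobMean (c : ℕ) (s : ℝ) : blobMean [(c, s), (1, 1)] = 1 + c * s := by
  simp only [blobMean]; push_cast; ring

/-- `ρ` is a caterpillar (blob forest) at every floor `0 < x ≤ s` (`s ≤ 1`, `x < 1`), top `c + 1`. [this work] -/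
theorem cat_lpRho (c : ℕ) (s x : ℝ) (hx0 : 0 < x) (hx1 : x < 1) (hxs : x ≤ s) (hs1 : s ≤ 1) :
    CatBuilt x (c + 1) (slice (pointLaw 1) c s) := by
  have h := catBuilt_blobLaw x hx0 hx1 [(c, s), (1, 1)] (fun p hp => by
    simp only [List.mem_cons, List.not_mem_nil, or_false] at hp
    rcases hp with rfl | rfl
    · exact ⟨hxs, hs1⟩
    · exact ⟨hx1.le, le_rfl⟩)
  rw [lpRho_blobTop, ← lpRho_eq_blobLaw] at h
  exact h

/-- mean of `ρ`: `Σ_{h ≤ c+1} h·ρ(h) = 1 + c·s`. [this work] -/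
theorem lpRho_mean (c : ℕ) (s : ℝ) : ∑ h ∈ Finset.range (c + 1 + 1), (h : ℝ) * slice (pointLaw 1) c s h = 1 + c * s := by
  rw [lpRho_eq_blobLaw, ← lpRho_blobTop c s, sum_mul_blobLaw, lpRho_blobMean]

/-- **THE LIGHT GLUED PAIR FOR EVERY ROOT GATE `q ≤ 1/2`** (every `c`, every `0 < s < 1`): `T = (R¹[q](R^c[s]))²` lies in the gated caterpillar
hull at its natural floor `y = q·s`, its mean `2q(1 + c s)` and its top `2c + 2` — the two-column member
`(1−q)·gate_{2q}(ρ) + q·gate_q(ρ ∗ ρ)` (`catPairBlob_inGatedCatHull_of_small` with `P = ρ`, `l = [(c,s),(1,1)]`, `s = t = q`). [this work] -/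
theorem lpT_inGatedCatHull_lowGate (c : ℕ) (q s : ℝ) (hq0 : 0 < q) (hq : q ≤ 1 / 2) (hs0 : 0 < s) (hs1 : s < 1) :
    InGatedCatHull (q * s) (2 * q * (1 + c * s)) (2 * c + 2) (lpT c q s) := by
  have hy0 : 0 < q * s := mul_pos hq0 hs0
  have hys : q * s < q := by nlinarith
  have hfl : q * s / q = s := by field_simp
  have hP : CatBuilt (q * s / q) (c + 1) (slice (pointLaw 1) c s) := by
    rw [hfl]; exact cat_lpRho c s s hs0 hs1 le_rfl hs1.le
  have hm : 0 < 1 + (c : ℝ) * s := by positivity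
  have key := catPairBlob_inGatedCatHull_of_small [(c, s), (1, 1)] hy0 hys le_rfl (by linarith) hP
    (fun p hp => by
      simp only [List.mem_cons, List.not_mem_nil, or_false] at hp
      rcases hp with rfl | rfl
      · exact ⟨hfl.le, hs1.le⟩
      · exact ⟨by rw [hfl]; exact hs1.le, le_rfl⟩)
    (by rw [lpRho_mean]; exact hm) (by rw [lpRho_blobMean]; exact hm)
    (by rw [lpRho_mean, lpRho_blobMean]; nlinarith) (by rw [lpRho_mean, lpRho_blobMean]; nlinarith)
  rw [lpRho_mean, lpRho_blobMean, lpRho_blobTop, ← lpRho_eq_blobLaw] at key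
  rw [show 2 * c + 2 = c + 1 + (c + 1) by omega, show 2 * q * (1 + c * s) = q * (1 + c * s) + q * (1 + c * s) by ring]
  exact key

/-- **… hence at every floor `0 < x ≤ qs`**, with the mean written as the law's own first moment. [this work] -/
theorem lpT_inGatedCatHull_lowGate_below (c : ℕ) (q s : ℝ) (hq0 : 0 < q) (hq : q ≤ 1 / 2) (hs0 : 0 < s) (hs1 : s < 1)
    (x : ℝ) (hx0 : 0 < x) (hx : x ≤ q * s) :
    InGatedCatHull x (∑ h ∈ Finset.range (2 * c + 2 + 1), (h : ℝ) * lpT c q s h) (2 * c + 2) (lpT c q s) := by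
  rw [lpT_mean]
  exact (lpT_inGatedCatHull_lowGate c q s hq0 hq hs0 hs1).mono hx0 hx

/-- **the light glued pair with root gate `q ≤ 1/2` is SDEC at its natural floor** (no oracle, no induction hypothesis). [this work] -/
theorem sdec_lpT_lowGate (c : ℕ) (q s : ℝ) (hq0 : 0 < q) (hq : q ≤ 1 / 2) (hs0 : 0 < s) (hs1 : s < 1) :
    SDEC (q * s) (2 * c + 2) (lpT c q s) :=
  sdec_of_inGatedCatHull (mul_pos hq0 hs0) (lpT_inGatedCatHull_lowGate c q s hq0 hq hs0 hs1)

/-- **every outer gate**: `gate T a ∈ FH(a·qs, a·2q(1+cs), 2c+2)` for `0 < a ≤ 1` (hull gating). [this work] -/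
theorem lpT_gate_inGatedCatHull_lowGate (c : ℕ) (q s : ℝ) (hq0 : 0 < q) (hq : q ≤ 1 / 2) (hs0 : 0 < s) (hs1 : s < 1)
    (a : ℝ) (ha0 : 0 < a) (ha1 : a ≤ 1) :
    InGatedCatHull (a * (q * s)) (a * (2 * q * (1 + c * s))) (2 * c + 2) (gate (lpT c q s) a) :=
  inGatedCatHull_gate (lpT_inGatedCatHull_lowGate c q s hq0 hq hs0 hs1) (mul_pos hq0 hs0).le a ha0 ha1

/-- **THE LIGHT NODE ON THESE LAWS**: every tree-built presentation `TreeBuilt x M T` at a floor `x ≤ qs` is in the hull at `x`, its own mean and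
its own top (any presentation has `M ≥ 2c + 2`, the law charging its top atom with `q²s² > 0`). [this work] -/
theorem treeBuiltCatHull_lpT_lowGate (c : ℕ) (q s : ℝ) (hq0 : 0 < q) (hq : q ≤ 1 / 2) (hs0 : 0 < s) (hs1 : s < 1)
    (x : ℝ) (M : ℕ) (hT : TreeBuilt x M (lpT c q s)) (hx : x ≤ q * s) :
    InGatedCatHull x (∑ h ∈ Finset.range (M + 1), (h : ℝ) * lpT c q s h) M (lpT c q s) := by
  obtain ⟨hx0, _, _, hzero, _, _⟩ := treeBuilt_lawFacts hT
  have hM : 2 * c + 2 ≤ M := by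
    by_contra hlt
    have h0 := hzero (2 * c + 2) (by omega)
    rw [lpT_apply] at h0
    have e : pointLaw (2 * c + 2) (2 * c + 2) = 1 := by simp [pointLaw_apply]
    rw [e] at h0
    have hq1 : 0 ≤ 1 - q := by linarith
    have hs1' : 0 ≤ 1 - s := by linarith
    have t0 : 0 ≤ (1 - q) ^ 2 * pointLaw 0 (2 * c + 2) := mul_nonneg (sq_nonneg _) (pointLaw_nonneg' _ _)
    have t1 : 0 ≤ 2 * q * (1 - q) * (1 - s) * pointLaw 1 (2 * c + 2) :=
      mul_nonneg (mul_nonneg (mul_nonneg (by positivity) hq1) hs1') (pointLaw_nonneg' _ _)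
    have t2 : 0 ≤ q ^ 2 * (1 - s) ^ 2 * pointLaw 2 (2 * c + 2) :=
      mul_nonneg (mul_nonneg (sq_nonneg _) (sq_nonneg _)) (pointLaw_nonneg' _ _)
    have t3 : 0 ≤ 2 * q * (1 - q) * s * pointLaw (c + 1) (2 * c + 2) :=
      mul_nonneg (mul_nonneg (mul_nonneg (by positivity) hq1) hs0.le) (pointLaw_nonneg' _ _)
    have t4 : 0 ≤ 2 * q ^ 2 * s * (1 - s) * pointLaw (c + 2) (2 * c + 2) :=
      mul_nonneg (mul_nonneg (by positivity) hs1') (pointLaw_nonneg' _ _)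
    have : 0 < q ^ 2 * s ^ 2 := by positivity
    linarith
  obtain ⟨a, rfl⟩ := Nat.exists_eq_add_of_le hM
  rw [sum_range_extend (fun h => (h : ℝ) * lpT c q s h) (2 * c + 2) a (fun h hh => by rw [lpT_eq_zero c q s h hh, mul_zero]),
    lpT_mean]
  exact ((lpT_inGatedCatHull_lowGate c q s hq0 hq hs0 hs1).mono hx0 hx).mono_top hM

end LawDec
end Quant
end Summit.CriticalPhenomena.PercolationContinuityZ3.Theorems
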